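import Summits.BirchSwinnertonDyer.BirchSwinnertonDyer.Theses.KolyvaginRankRigidityAtTwo
import Summits.BirchSwinnertonDyer.BirchSwinnertonDyer.Theorems.KolyvaginRankRigidityAtTwoRingClassNoTwoTorsion
import Summits.BirchSwinnertonDyer.BirchSwinnertonDyer.Theorems.KolyvaginRoadThreeClassCertificate
import Summits.BirchSwinnertonDyer.BirchSwinnertonDyer.Theorems.ErratumRoadFiveNonSurjCornerKolyJProp44StandingInputs
import HarnessLib

/-!
# Crux V1′ `KolyvaginNonvanishingAtTwoFrame` (stmt-BirchSwinnertonDyer-24622): the crux and its open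
# stub `stub_torsionLevelOne` in McCallum's POINT currency — at `p = 2`, at EVERY Kolyvagin level,
# `c_M(n) ≠ 0 ⟺ 2^M ∤ P(n)` in `E(K[n])`

Width prover `bsd-line-krr2-p2` (g5); `--supports stmt-BirchSwinnertonDyer-24622`. THEOREMS ONLY (no
definition, no named fact, no `sorry`). BSD is not proved by any of this; Kolyvagin's conjecture at
`2` is NOT asserted — it is RE-EXPRESSED.

WHY. V1′ (Kolyvagin's conjecture at `p = 2` on the surjective-2-adic habitat, universal frame) asks for
a non-zero CLASS `c_M(n) = d.kolyvaginClass Nat.prime_two M` (McCallum's cocycle of the derived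
Heegner point `P(n)`, Gross 1991 (4.6)). Everything one can COMPUTE (the pen's instrument KOLY2:
`P(ℓ) mod 2E(K[ℓ])` for `389a1, 563a1, …`) or hope to PROVE by Heegner-point arithmetic is the POINT
statement `P(n) ∉ 2^M E(K[n])`. McCallum's Cor. 4.5 «`c_M(n) = 0` iff `P_n ∈ p^M E(K_n)`» turns one
into the other GIVEN the two standing inputs of the cocycle, both printed for odd `p` only:
(hA) `E(K[n]) ⊆ E(K̄)` is `2^M`-admissible — Gross's Lemma 4.3 AT `2`, supplied on the habitat by the
sibling helper `isAdmissible_pointsSubgroup_two` (genus theory; a Kolyvagin level `n` at `2` is odd —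
`2 ∣ ℓ + 1` — and prime to `N_E`), and (hP) `[P(n)]` is `Γ_K`-invariant mod `2^M` for `M ≤ M(n)` —
Gross's Prop. 3.6, whose tree proof `Prop44.toGeomPoints_derivedPoint_mem_invPoints` is uniform in
`p` (it needs `d_K < −4`, i.e. `𝒪_K^× = ±1`, which `d_K` odd `≠ −3` gives). Hence, kernel-checked:

* `kolyvaginClass_two_ne_zero_iff_not_pDiv` — on V1′'s habitat, for every frame, every square-free
  product `n` of Kolyvagin primes at `2`, every datum `d` at level `n` and every `M ≤ M(n)`:
  `d.kolyvaginClass Nat.prime_two M ≠ 0 ↔ ¬ Koly.PDiv d 2 M` (the pen's worry *"injectivity at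
  `p = 2` unverified"* for the KOLY2 rows is thereby settled on the habitat: a point certificate IS a
  non-zero class, and conversely);
* `kolyvaginNonvanishingAtTwoFrame_iff_pointForm` — V1′ is EQUIVALENT to its point form «… ⇒ ∃ n d M,
  n Kolyvagin-square-free, 1 ≤ M ≤ M(n), P(n) ∉ 2^M E(K[n])»;
* `stub_torsionLevelOne_iff_pointForm` — the OPEN registered stub of line `V1f_birth` (the torsion
  case: every conductor-`1` derived point `P(1) = y_K` is torsion) is EQUIVALENT to «… ⇒ some derived
  Heegner point `P(n)` at a Kolyvagin level is not `2^M`-divisible in `E(K[n])`, `1 ≤ M ≤ M(n)`» —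
  Kolyvagin's conjecture at `2` in the currency of Kolyvagin 1991 / W. Zhang 2014 Thm. 1.1
  (`κ^∞ ≠ 0` read on points), which is what a proof by level raising / Jetchev–Zhang induction or a
  computation would deliver.

Small habitat lemmas: `not_two_dvd_of_kolSupp_two` (Kolyvagin levels at `2` are odd),
`coprime_of_kolSupp` (and prime to `N_E`); `d_K` odd `≠ −3` ⇒ `d_K < −4` is inlined (the tree's
`GenusKoly.discr_lt_neg_four_of_odd`).

References (locators only): [cite: McCallumLMS1991, §4 (4)–(6), Cor. 4.5] [cite: GrossLMS1991, §3
(3.3), Prop. 3.6, §4 Lemma 4.3, Prop. 4.7 (1)] [cite: WZhang2014, Notations (xii), Thm. 1.1]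
[cite: Kolyvagin1991, §1 Conj. A / (1.1)].
-/

set_option autoImplicit false
-- the Theorems namespace of this sub repeats the summit name by design (D-0017 nested layout)
set_option linter.dupNamespace false

noncomputable section

open scoped Classical

open WeierstrassCurve Field Literature.NumberTheory.EllipticCurves
  Literature.NumberTheory.EllipticCurves.ModularForms
  Literature.NumberTheory.EllipticCurves.KolyvaginCocycle
open Summit.BirchSwinnertonDyer.Rank1Residual.X11b
open Summit.BirchSwinnertonDyer.Rank1Residual.X11b.Three
open Summit.BirchSwinnertonDyer.BirchSwinnertonDyer.Theses.KolyvaginRankRigidityAtTwo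

namespace Summit.BirchSwinnertonDyer.BirchSwinnertonDyer.Theorems.KolyvaginRankRigidity

/-! ## §1 Habitat lemmas: Kolyvagin levels at `2` are odd and prime to `N_E` -/

section Habitat

variable {K : Type} [Field K] [NumberField K]

/-- A square-free product of Kolyvagin primes at `p = 2` is ODD: a Kolyvagin prime `ℓ` at `2` has
`ℓ ≠ 2` (Zhang 2014, Notations (xii): `ℓ ∤ NDp`; indeed `2 ∣ ℓ + 1`). [cite: WZhang2014, Notations (xii)] -/
theorem not_two_dvd_of_kolSupp_two {N : ℕ} {W : WeierstrassCurve ℚ} [W.IsGloballyMinimal] {n : ℕ}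
    (hn : KolyvaginDescent.KolSupp (Zhang2014.IsKolyvaginPrime N W K 2) n) : ¬ 2 ∣ n := fun h2 ↦
  (hn.2 2 (Nat.mem_primeFactors.mpr ⟨Nat.prime_two, h2, hn.1.ne_zero⟩)).2.2.2.1 rfl

/-- A square-free product of Kolyvagin primes (any `p`) is prime to the level `N` (`ℓ ∤ N` for each
prime factor). [cite: WZhang2014, Notations (xii)] -/
theorem coprime_of_kolSupp {N : ℕ} {W : WeierstrassCurve ℚ} [W.IsGloballyMinimal] {p n : ℕ}
    (hn : KolyvaginDescent.KolSupp (Zhang2014.IsKolyvaginPrime N W K p) n) : Nat.Coprime N n :=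
  Nat.coprime_of_dvd fun k hk hkN hkn ↦
    (hn.2 k (Nat.mem_primeFactors.mpr ⟨hk, hkn, hn.1.ne_zero⟩)).2.1 hkN

end Habitat

/-! ## §2 `c_M(n) ≠ 0 ⟺ 2^M ∤ P(n)` at every Kolyvagin level, `p = 2` -/

section Frame

-- `K : Type`: the tree's ring-class class field theory is universe `0` (as in the crux).
variable {K : Type} [Field K] [NumberField K] (W : WeierstrassCurve ℚ) [W.IsElliptic]
  [W.IsGloballyMinimal] [NeZero (W.conductorNorm ℤ)]
  {Dt : ModularParametrizationData W (W.conductorNorm ℤ)} {β : ℤ} {ι : K →+* ℂ}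

/-- **McCallum's Cor. 4.5 AT `p = 2` with BOTH standing inputs supplied, at every Kolyvagin level.**
For `W/ℚ` globally minimal elliptic with `ρ̄_{E,2}` onto, `K` imaginary quadratic with `d_K` odd
`≠ −3` and the Heegner hypothesis for `N_E`, a frame `(Dt, β, ι)`, a square-free product `n` of
Kolyvagin primes at `2`, a Kolyvagin–Heegner datum `d` at level `n` and `M ≤ M(n)`:
`c_M(n) ≠ 0 ↔ P(n) ∉ 2^M E(K[n])`. Inputs: (hA) Gross Lemma 4.3 at `2`
(`isAdmissible_pointsSubgroup_two`; `n` is odd and prime to `N_E`), (hP) Gross Prop. 3.6 for a concrete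
datum (`Prop44.toGeomPoints_derivedPoint_mem_invPoints`, any `p`; `d_K < −4`), and McCallum Cor. 4.5 in
iff form (`KolyCert.kolyvaginClass_ne_zero_iff`). [cite: McCallumLMS1991, §4 (4)–(5) and Cor. 4.5]
[cite: GrossLMS1991, Prop. 3.6, §4 Lemma 4.3, Prop. 4.7 (1)] [cite: WZhang2014, Notations (xii)] -/
theorem kolyvaginClass_two_ne_zero_iff_not_pDiv (hs : W.HasSurjectiveModNGaloisRep 2)
    (hK : IsImaginaryQuadratic K) (hodd : Odd (NumberField.discr K))
    (hne3 : NumberField.discr K ≠ -3) (hH : SatisfiesHeegnerHypothesis (W.conductorNorm ℤ) K)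
    {n : ℕ} (hn : KolyvaginDescent.KolSupp (Zhang2014.IsKolyvaginPrime (W.conductorNorm ℤ) W K 2) n)
    (d : KolyvaginHeegnerData Dt β ι n) {M : ℕ} (hM : (M : ℕ∞) ≤ Zhang2014.levelIndex W 2 n) :
    d.kolyvaginClass Nat.prime_two M ≠ 0 ↔ ¬ Koly.PDiv d 2 M := by
  have h2D : ¬ (2 : ℤ) ∣ NumberField.discr K := fun h ↦
    Int.not_even_iff_odd.mpr hodd (even_iff_two_dvd.mpr h)
  have hA : IsAdmissible (absoluteGaloisGroup K) d.pointsSubgroup ((2 ^ M : ℕ) : ℤ) :=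
    isAdmissible_pointsSubgroup_two d hs hK h2D hH hn.1.ne_zero (not_two_dvd_of_kolSupp_two hn)
      (coprime_of_kolSupp hn) M
  -- `d_K < −4` (`d_K < 0`, `|d_K| > 2` by Minkowski, `d_K` odd `≠ −3`): `𝒪_K^× = ±1` for Prop. 3.6
  -- (also the tree's `GenusKoly.discr_lt_neg_four_of_odd`, not imported to keep the cone small)
  have hD : NumberField.discr K < -4 := by
    have hneg : NumberField.discr K < 0 := hK.discr_neg
    have h2 : 2 < |NumberField.discr K| :=
      NumberField.abs_discr_gt_two (by rw [hK.1]; exact one_lt_two)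
    rw [abs_of_neg hneg] at h2
    obtain ⟨k, hk⟩ := hodd
    omega
  have hP : d.toGeomPoints d.derivedPoint ∈
      invPoints (absoluteGaloisGroup K) d.pointsSubgroup ((2 ^ M : ℕ) : ℤ) :=
    Theorems.Prop44.toGeomPoints_derivedPoint_mem_invPoints hK ι hD hH Dt Nat.prime_two hn.1
      (fun q hq ↦ ⟨hn.2 q hq, (Zhang2014.natCast_le_levelIndex_iff.mp hM) q hq⟩) d
  rw [KolyCert.kolyvaginClass_ne_zero_iff]
  exact ⟨fun h ↦ h.2.2, fun h ↦ ⟨hA, hP, h⟩⟩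

/-- The same equivalence for `c_M(n) = 0`: **`c_M(n) = 0 ⟺ 2^M ∣ P(n)` in `E(K[n])`**, at `p = 2`
on the habitat. [cite: McCallumLMS1991, Cor. 4.5] [cite: GrossLMS1991, Prop. 4.7 (1)] -/
theorem kolyvaginClass_two_eq_zero_iff_pDiv (hs : W.HasSurjectiveModNGaloisRep 2)
    (hK : IsImaginaryQuadratic K) (hodd : Odd (NumberField.discr K))
    (hne3 : NumberField.discr K ≠ -3) (hH : SatisfiesHeegnerHypothesis (W.conductorNorm ℤ) K)
    {n : ℕ} (hn : KolyvaginDescent.KolSupp (Zhang2014.IsKolyvaginPrime (W.conductorNorm ℤ) W K 2) n)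
    (d : KolyvaginHeegnerData Dt β ι n) {M : ℕ} (hM : (M : ℕ∞) ≤ Zhang2014.levelIndex W 2 n) :
    d.kolyvaginClass Nat.prime_two M = 0 ↔ Koly.PDiv d 2 M := by
  have h := kolyvaginClass_two_ne_zero_iff_not_pDiv W hs hK hodd hne3 hH hn d hM
  tauto

end Frame

/-! ## §3 V1′ and its open stub in point currency -/

/-- **V1′ `KolyvaginNonvanishingAtTwoFrame` is EQUIVALENT to its McCallum point form.** Kolyvagin's
conjecture at `p = 2` on the surjective-2-adic habitat (universal frame), as typed, holds iff on the
same habitat and for every frame some derived Heegner point `P(n)` at a square-free product `n` of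
Kolyvagin primes at `2` is NOT `2^M`-divisible in `E(K[n])` for some `1 ≤ M ≤ M(n)`
(`kolyvaginClass_two_ne_zero_iff_not_pDiv` pointwise; only `m = 1` of the surjectivity hypothesis is
used). Nothing is asserted about either side. [cite: McCallumLMS1991, Cor. 4.5]
[cite: Kolyvagin1991, §1 (1.1)] [cite: WZhang2014, Thm. 1.1 (κ^∞ ≠ 0)] -/
theorem kolyvaginNonvanishingAtTwoFrame_iff_pointForm :
    KolyvaginNonvanishingAtTwoFrame ↔
      ∀ (W : WeierstrassCurve ℚ) [W.IsElliptic] [W.IsGloballyMinimal], ¬ W.HasCM →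
        (Literature.NumberTheory.EllipticCurves.Rank1Residual.GoodOrd W 2 ∨
          Literature.NumberTheory.EllipticCurves.Rank1Residual.Mult W 2) →
        (∀ m : ℕ, W.HasSurjectiveModNGaloisRep (2 ^ m : ℕ)) →
        ∀ (K : Type) [Field K] [NumberField K],
          Literature.NumberTheory.EllipticCurves.IsImaginaryQuadratic K →
          ∀ [NeZero (W.conductorNorm ℤ)],
            Literature.NumberTheory.EllipticCurves.SatisfiesHeegnerHypothesis (W.conductorNorm ℤ) K →
            Odd (NumberField.discr K) → NumberField.discr K ≠ -3 →
            AddSubgroup.torsionBy (W.baseChange K).toAffine.Point (2 : ℤ) = ⊥ →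
            Literature.NumberTheory.EllipticCurves.SatisfiesHeegnerHypothesis 2 K →
            ∀ (Dt : Literature.NumberTheory.EllipticCurves.ModularForms.ModularParametrizationData W
                (W.conductorNorm ℤ)) (β : ℤ) (ι : K →+* ℂ),
              (4 * (W.conductorNorm ℤ : ℤ)) ∣ β ^ 2 - NumberField.discr K →
              ∃ (n : ℕ) (d : Literature.NumberTheory.EllipticCurves.KolyvaginHeegnerData Dt β ι n)
                (M : ℕ),
                Literature.NumberTheory.EllipticCurves.KolyvaginDescent.KolSupp
                    (Literature.NumberTheory.EllipticCurves.Zhang2014.IsKolyvaginPrime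
                      (W.conductorNorm ℤ) W K 2) n ∧
                  1 ≤ M ∧
                  (M : ℕ∞) ≤ Literature.NumberTheory.EllipticCurves.Zhang2014.levelIndex W 2 n ∧
                  ¬ Koly.PDiv d 2 M := by
  unfold KolyvaginNonvanishingAtTwoFrame
  refine forall_congr' fun W ↦ forall_congr' fun _ ↦ forall_congr' fun _ ↦ forall_congr' fun _ ↦
    forall_congr' fun _ ↦ forall_congr' fun hsur ↦ forall_congr' fun K ↦ forall_congr' fun _ ↦
    forall_congr' fun _ ↦ forall_congr' fun hK ↦ forall_congr' fun _ ↦ forall_congr' fun hH ↦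
    forall_congr' fun hodd ↦ forall_congr' fun hne3 ↦ forall_congr' fun _ ↦ forall_congr' fun _ ↦
    forall_congr' fun Dt ↦ forall_congr' fun β ↦ forall_congr' fun ι ↦ forall_congr' fun _ ↦ ?_
  have hs : W.HasSurjectiveModNGaloisRep ((2 ^ 1 : ℕ) : ℤ) := hsur 1
  rw [pow_one] at hs
  refine exists_congr fun n ↦ exists_congr fun d ↦ exists_congr fun M ↦ ?_
  refine ⟨fun ⟨hn, h1, hM, hne⟩ ↦ ⟨hn, h1, hM, ?_⟩, fun ⟨hn, h1, hM, hne⟩ ↦ ⟨hn, h1, hM, ?_⟩⟩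
  · exact (kolyvaginClass_two_ne_zero_iff_not_pDiv W hs hK hodd hne3 hH hn d hM).mp hne
  · exact (kolyvaginClass_two_ne_zero_iff_not_pDiv W hs hK hodd hne3 hH hn d hM).mpr hne

/-- **The open stub `stub_torsionLevelOne` of line `V1f_birth` (crux V1′, stmt-BirchSwinnertonDyer-24622)
is EQUIVALENT to its point form** — the torsion case of Kolyvagin's conjecture at `2` («every
conductor-`1` derived point `P(1) = y_K` is torsion, i.e. — granted Gross–Zagier — `ord_{s=1} L(E/K,s) ≥ 3`
on the habitat — yet some Kolyvagin class at `2` is non-zero») holds iff, under the same binders, some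
derived Heegner point `P(n)` at a square-free product of Kolyvagin primes at `2` is not
`2^M`-divisible in `E(K[n])` for some `1 ≤ M ≤ M(n)` (necessarily `n > 1`: at `n = 1` a torsion
`P(1)` is `2^M`-divisible in the `2`-torsion-free `E(K[1])`). This is the statement a port of
W. Zhang's induction (Thm. 1.1, `p ≥ 5`) or of Kolyvagin 1991 to `ℓ = 2` would have to deliver; it is
NOT proved here. [cite: WZhang2014, Thm. 1.1 and §3.7 (3.21)] [cite: Kolyvagin1991, §1 (1.1)]
[cite: McCallumLMS1991, Cor. 4.5] -/
theorem stub_torsionLevelOne_iff_pointForm :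
    (∀ (W : WeierstrassCurve ℚ) [W.IsElliptic] [W.IsGloballyMinimal], ¬ W.HasCM →
        (Literature.NumberTheory.EllipticCurves.Rank1Residual.GoodOrd W 2 ∨
          Literature.NumberTheory.EllipticCurves.Rank1Residual.Mult W 2) →
        (∀ m : ℕ, W.HasSurjectiveModNGaloisRep (2 ^ m : ℕ)) →
        ∀ (K : Type) [Field K] [NumberField K],
          Literature.NumberTheory.EllipticCurves.IsImaginaryQuadratic K →
          ∀ [NeZero (W.conductorNorm ℤ)],
            Literature.NumberTheory.EllipticCurves.SatisfiesHeegnerHypothesis (W.conductorNorm ℤ) K →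
            Odd (NumberField.discr K) → NumberField.discr K ≠ -3 →
            AddSubgroup.torsionBy (W.baseChange K).toAffine.Point (2 : ℤ) = ⊥ →
            Literature.NumberTheory.EllipticCurves.SatisfiesHeegnerHypothesis 2 K →
            ∀ (Dt : Literature.NumberTheory.EllipticCurves.ModularForms.ModularParametrizationData W
                (W.conductorNorm ℤ)) (β : ℤ) (ι : K →+* ℂ),
              (4 * (W.conductorNorm ℤ : ℤ)) ∣ β ^ 2 - NumberField.discr K →
              (∀ d₁ : Literature.NumberTheory.EllipticCurves.KolyvaginHeegnerData Dt β ι 1,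
                IsOfFinAddOrder d₁.derivedPoint) →
              ∃ (n : ℕ) (d : Literature.NumberTheory.EllipticCurves.KolyvaginHeegnerData Dt β ι n)
                (M : ℕ),
                Literature.NumberTheory.EllipticCurves.KolyvaginDescent.KolSupp
                    (Literature.NumberTheory.EllipticCurves.Zhang2014.IsKolyvaginPrime
                      (W.conductorNorm ℤ) W K 2) n ∧
                  1 ≤ M ∧
                  (M : ℕ∞) ≤ Literature.NumberTheory.EllipticCurves.Zhang2014.levelIndex W 2 n ∧
                  d.kolyvaginClass Nat.prime_two M ≠ 0) ↔
    (∀ (W : WeierstrassCurve ℚ) [W.IsElliptic] [W.IsGloballyMinimal], ¬ W.HasCM →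
        (Literature.NumberTheory.EllipticCurves.Rank1Residual.GoodOrd W 2 ∨
          Literature.NumberTheory.EllipticCurves.Rank1Residual.Mult W 2) →
        (∀ m : ℕ, W.HasSurjectiveModNGaloisRep (2 ^ m : ℕ)) →
        ∀ (K : Type) [Field K] [NumberField K],
          Literature.NumberTheory.EllipticCurves.IsImaginaryQuadratic K →
          ∀ [NeZero (W.conductorNorm ℤ)],
            Literature.NumberTheory.EllipticCurves.SatisfiesHeegnerHypothesis (W.conductorNorm ℤ) K →
            Odd (NumberField.discr K) → NumberField.discr K ≠ -3 →
            AddSubgroup.torsionBy (W.baseChange K).toAffine.Point (2 : ℤ) = ⊥ →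
            Literature.NumberTheory.EllipticCurves.SatisfiesHeegnerHypothesis 2 K →
            ∀ (Dt : Literature.NumberTheory.EllipticCurves.ModularForms.ModularParametrizationData W
                (W.conductorNorm ℤ)) (β : ℤ) (ι : K →+* ℂ),
              (4 * (W.conductorNorm ℤ : ℤ)) ∣ β ^ 2 - NumberField.discr K →
              (∀ d₁ : Literature.NumberTheory.EllipticCurves.KolyvaginHeegnerData Dt β ι 1,
                IsOfFinAddOrder d₁.derivedPoint) →
              ∃ (n : ℕ) (d : Literature.NumberTheory.EllipticCurves.KolyvaginHeegnerData Dt β ι n)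
                (M : ℕ),
                Literature.NumberTheory.EllipticCurves.KolyvaginDescent.KolSupp
                    (Literature.NumberTheory.EllipticCurves.Zhang2014.IsKolyvaginPrime
                      (W.conductorNorm ℤ) W K 2) n ∧
                  1 ≤ M ∧
                  (M : ℕ∞) ≤ Literature.NumberTheory.EllipticCurves.Zhang2014.levelIndex W 2 n ∧
                  ¬ Koly.PDiv d 2 M) := by
  refine forall_congr' fun W ↦ forall_congr' fun _ ↦ forall_congr' fun _ ↦ forall_congr' fun _ ↦
    forall_congr' fun _ ↦ forall_congr' fun hsur ↦ forall_congr' fun K ↦ forall_congr' fun _ ↦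
    forall_congr' fun _ ↦ forall_congr' fun hK ↦ forall_congr' fun _ ↦ forall_congr' fun hH ↦
    forall_congr' fun hodd ↦ forall_congr' fun hne3 ↦ forall_congr' fun _ ↦ forall_congr' fun _ ↦
    forall_congr' fun Dt ↦ forall_congr' fun β ↦ forall_congr' fun ι ↦ forall_congr' fun _ ↦
    forall_congr' fun _ ↦ ?_
  have hs : W.HasSurjectiveModNGaloisRep ((2 ^ 1 : ℕ) : ℤ) := hsur 1
  rw [pow_one] at hs
  refine exists_congr fun n ↦ exists_congr fun d ↦ exists_congr fun M ↦ ?_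
  refine ⟨fun ⟨hn, h1, hM, hne⟩ ↦ ⟨hn, h1, hM, ?_⟩, fun ⟨hn, h1, hM, hne⟩ ↦ ⟨hn, h1, hM, ?_⟩⟩
  · exact (kolyvaginClass_two_ne_zero_iff_not_pDiv W hs hK hodd hne3 hH hn d hM).mp hne
  · exact (kolyvaginClass_two_ne_zero_iff_not_pDiv W hs hK hodd hne3 hH hn d hM).mpr hne

/-- **In the torsion case the witness level is positive**: on the habitat, if every conductor-`1`
derived point is torsion then any non-zero class `c_M(n) ≠ 0` at a Kolyvagin level with `M ≤ M(n)`
has `n ≠ 1` — at `n = 1` a torsion `P(1)` is `2^M`-divisible in `E(K[1])` (tree: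
`heegnerSystem_kolyvaginClass_eq_zero_of_isOfFinAddOrder`, Gross Prop. 4.7 (1)), so `c_M(1) = 0`.
(The depth of Kolyvagin's conjecture at `2` in the torsion case is `≥ 1`.)
[cite: GrossLMS1991, Prop. 4.7 (1)] [cite: WZhang2014, proof of Thm. 1.3 (p. 196)] -/
theorem level_ne_one_of_forall_isOfFinAddOrder {K : Type} [Field K] [NumberField K]
    {W : WeierstrassCurve ℚ} [NeZero (W.conductorNorm ℤ)]
    {Dt : ModularParametrizationData W (W.conductorNorm ℤ)} {β : ℤ} {ι : K →+* ℂ}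
    (htor : ∀ d₁ : KolyvaginHeegnerData Dt β ι 1, IsOfFinAddOrder d₁.derivedPoint)
    {n : ℕ} (d : KolyvaginHeegnerData Dt β ι n) {M : ℕ} (hne : d.kolyvaginClass Nat.prime_two M ≠ 0) :
    n ≠ 1 := by
  rintro rfl
  exact hne (heegnerSystem_kolyvaginClass_eq_zero_of_isOfFinAddOrder d Nat.prime_two M (htor d))

end Summit.BirchSwinnertonDyer.BirchSwinnertonDyer.Theorems.KolyvaginRankRigidity

end
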